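import Literature.AlgebraicGeometry.Resolution.GRingAdicCompletionRegularHom
import Literature.AlgebraicGeometry.Resolution.RegularHomReduced
import Literature.AlgebraicGeometry.Resolution.RegularCentreLocal
import Mathlib.RingTheory.LocalRing.ResidueField.Fiber
import Mathlib.RingTheory.Localization.BaseChange
import Mathlib.FieldTheory.KummerPolynomial
import Mathlib.RingTheory.Flat.Basic
import Mathlib.Algebra.CharP.Algebra
import HarnessLib

/-!
# P3c≤3 EXISTENCE, (EX-4) (L5) input (FF-sep): THE RESIDUE FIELD OF THE GENERIC FORMAL FIBRE OVER A PRIME OF A LOCAL G-RING IS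
# RELATIVELY `p`-RADICALLY CLOSED (door `HypersurfaceCentreConstruction`, stmt-ResolutionOfSingularities-19897; (o70-a) step (EX-4);
# hand res-D-pv-038, FINDING HOME/STATUS 2026-08-27T20:54:18Z)

Topic: `Summits/ResolutionOfSingularities/ResolutionOfSingularities/Theorems`. Helper for the door item `HypersurfaceCentreConstruction`
(stmt-ResolutionOfSingularities-19897, route `WeightedInvariant`), line `local-engine` (L W4.3), def-free.  Discharges the hypothesis `hcl` of
`RatContact.levelBound_tie_of_dominance` (`…Iota3SigmaLevelLimitTie`): for a local G-ring `S` with completion `Ŝ` and a prime `P` with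
`P Ŝ` prime, the residue field extension `κ(P) = κ(S_P) ⊆ κ(Ŝ_{PŜ}) = Frac(Ŝ/PŜ)` is relatively `p`-radically closed (`z^p ∈ κ(P) ⇒ z ∈ κ(P)`).
This is the separability of the generic formal fibre, a consequence of the geometric regularity of the formal fibres of a G-ring
([Matsumura1987] §32 p. 256; EGA IV₂ (7.8.3) (v)); it is GENUINELY needed by Abramovich–Quek–Schober's base change (the lex-maximal slope
jumps under inseparable residue extensions: `y^p − t x^p`).

* §1 `not_isReduced_adjoinRoot_tensor` — `K(c^{1/p}) ⊗_K L` is not reduced when `c = z^p` in `L` (pure field theory).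
* §2 `isRegularRing_tensor_of_isLocalization` — localising a geometrically regular algebra keeps `k′ ⊗_K (·)` regular.
* §3 `pRadicallyClosed_residueField_adicCompletion` — (FF-sep), in the binder shape of `levelBound_tie_of_dominance`'s `hcl`.

[OURS · L1 W4.3 · (o70-a) step (EX-4) (L5)]  Replaces the role of NO printed item; NOT a statement of the manuscript
[claim: Hironaka2017, status: under-review]. AI work, weaker than expert review.  Pure commutative algebra over Mathlib's `Ideal.Fiber` and
the tree's `IsGRing` / `IsRegularHom`; no named facts.

## References

* H. Matsumura, *Commutative Ring Theory* (1987), §32 pp. 255–256 (geometrically regular, regular homomorphisms, G-rings). [Matsumura1987]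
* A. Grothendieck, EGA IV₂, Publ. Math. IHÉS 24 (1965), (7.8.3) (v). [EGAIV2]
-/

noncomputable section

open Polynomial TensorProduct IsLocalRing
open Literature.AlgebraicGeometry.Resolution

set_option linter.dupNamespace false -- mandated namespace of this single-conjunct summit

namespace Summit.ResolutionOfSingularities.ResolutionOfSingularities.Cruxes.HypersurfaceCentreConstruction.LocalEngine

namespace FormalFibre

/-! ## §1 The non-reduced algebra `K(c^{1/p}) ⊗_K L` when `c` becomes a `p`-th power in `L` -/
section Nilp

variable {K L : Type} [Field K] [Field L] [Algebra K L]

/-- **`K(c^{1/p}) ⊗_K L` is not reduced if `c ∈ K ∖ K^p` becomes a `p`-th power `z^p` in `L`**: `θ ⊗ 1 − 1 ⊗ z` is a non-zero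
nilpotent (`(θ ⊗ 1 − 1 ⊗ z)^p = c ⊗ 1 − 1 ⊗ c = 0`; the `θ`-coordinate of `θ ⊗ 1 − 1 ⊗ z` is `1`). [folklore] -/
theorem not_isReduced_adjoinRoot_tensor (p : ℕ) [hp : Fact p.Prime] [CharP K p] (c : K) (hc : ∀ w : K, w ^ p ≠ c)
    (z : L) (hz : z ^ p = algebraMap K L c) :
    haveI : Fact (Irreducible (X ^ p - C c)) := ⟨X_pow_sub_C_irreducible_of_prime hp.out hc⟩
    ¬ IsReduced (AdjoinRoot (X ^ p - C c : K[X]) ⊗[K] L) := by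
  haveI hirr : Fact (Irreducible (X ^ p - C c)) := ⟨X_pow_sub_C_irreducible_of_prime hp.out hc⟩
  intro hred
  set f : K[X] := X ^ p - C c with hf
  have hmonic : f.Monic := by rw [hf]; exact monic_X_pow_sub_C c hp.out.ne_zero
  set θ : AdjoinRoot f := AdjoinRoot.root f
  have hθ : θ ^ p = algebraMap K (AdjoinRoot f) c := by
    have h := AdjoinRoot.eval₂_root f
    rw [hf, eval₂_sub, eval₂_X_pow, eval₂_C, sub_eq_zero] at h
    exact h
  set u : AdjoinRoot f ⊗[K] L := θ ⊗ₜ 1 - 1 ⊗ₜ z with hu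
  haveI : CharP L p := charP_of_injective_algebraMap (algebraMap K L).injective p
  haveI : CharP (AdjoinRoot f) p := charP_of_injective_algebraMap (algebraMap K (AdjoinRoot f)).injective p
  haveI : CharP (AdjoinRoot f ⊗[K] L) p :=
    charP_of_injective_algebraMap (Algebra.TensorProduct.includeLeft_injective (R := K) (S := K) (A := AdjoinRoot f) (B := L)
      (algebraMap K L).injective) p
  have hup : u ^ p = 0 := by
    rw [hu, sub_pow_char_of_commute p (Commute.all _ _), Algebra.TensorProduct.tmul_pow, Algebra.TensorProduct.tmul_pow,
      one_pow, one_pow, hz, hθ, Algebra.algebraMap_eq_smul_one, Algebra.algebraMap_eq_smul_one, ← smul_tmul, sub_self]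
  have hu0 : u = 0 := hred.eq_zero u ⟨p, hup⟩
  -- the coordinate of `θ` detects `u`
  have hp1 : 1 < f.natDegree := by rw [hf, natDegree_X_pow_sub_C]; exact hp.out.one_lt
  let B := AdjoinRoot.powerBasis' hmonic
  have hdim : B.dim = f.natDegree := AdjoinRoot.powerBasis'_dim hmonic
  let i1 : Fin B.dim := ⟨1, by rw [hdim]; exact hp1⟩
  let i0 : Fin B.dim := ⟨0, by rw [hdim]; omega⟩
  have hB1 : B.basis i1 = θ := by
    rw [PowerBasis.coe_basis]; show B.gen ^ (1 : ℕ) = θ; rw [pow_one]; rfl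
  have hB0 : B.basis i0 = 1 := by
    rw [PowerBasis.coe_basis]; show B.gen ^ (0 : ℕ) = 1; rw [pow_zero]
  let φ : AdjoinRoot f ⊗[K] L →ₗ[K] K ⊗[K] L := TensorProduct.map (B.basis.coord i1) LinearMap.id
  have h1 : φ u = (1 : K) ⊗ₜ (1 : L) - (0 : K) ⊗ₜ z := by
    rw [hu, map_sub, TensorProduct.map_tmul, TensorProduct.map_tmul, LinearMap.id_apply, LinearMap.id_apply,
      ← hB0, ← hB1, Module.Basis.coord_apply, Module.Basis.coord_apply, Module.Basis.repr_self, Module.Basis.repr_self,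
      Finsupp.single_eq_same, Finsupp.single_eq_of_ne (by intro h; exact absurd (congrArg Fin.val h) (by norm_num))]
  rw [hu0, map_zero, zero_tmul, sub_zero, eq_comm] at h1
  have h2 := congrArg (TensorProduct.lid K L) h1
  rw [TensorProduct.lid_tmul, one_smul, map_zero] at h2
  exact one_ne_zero h2

end Nilp

/-! ## §2 Localising a geometrically regular fibre -/
section LemA

/-- **Localising a geometrically regular algebra**: if `k′ ⊗_K F` is a regular ring and `L_q` is a localisation of `F` (or anything
`K`-isomorphic to one), then `k′ ⊗_K L_q` is a regular ring (`L_q ⊗_F (F ⊗_K k′)` is a localisation of `F ⊗_K k′`, Mathlib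
`IsLocalization.tensorRight`, and `≅ L_q ⊗_K k′`, Mathlib `Algebra.TensorProduct.cancelBaseChange`). [cite: Matsumura1987, §32 p. 255] -/
theorem isRegularRing_tensor_of_isLocalization {K F : Type} [Field K] [CommRing F] [Algebra K F] (M : Submonoid F)
    (Lq : Type) [CommRing Lq] [Algebra F Lq] [Algebra K Lq] [IsScalarTower K F Lq] [IsLocalization M Lq]
    (L' : Type) [CommRing L'] [Algebra K L'] (e : Lq ≃ₐ[K] L')
    (k' : Type) [Field k'] [Algebra K k'] (h : IsRegularRing (k' ⊗[K] F)) : IsRegularRing (k' ⊗[K] L') := by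
  have h1 : IsRegularRing (F ⊗[K] k') := by
    haveI := h
    exact IsRegularRing.of_ringEquiv (R := k' ⊗[K] F) (Algebra.TensorProduct.comm K k' F).toRingEquiv
  letI : Algebra (F ⊗[K] k') (Lq ⊗[F] (F ⊗[K] k')) := Algebra.TensorProduct.rightAlgebra
  haveI : IsLocalization (Algebra.algebraMapSubmonoid (F ⊗[K] k') M) (Lq ⊗[F] (F ⊗[K] k')) :=
    IsLocalization.tensorRight (R := F) (A := Lq) M
  haveI := h1
  have h2 : IsRegularRing (Lq ⊗[F] (F ⊗[K] k')) := isRegularRing_of_isLocalization (Algebra.algebraMapSubmonoid (F ⊗[K] k') M) _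
  haveI := h2
  exact IsRegularRing.of_ringEquiv (R := Lq ⊗[F] (F ⊗[K] k'))
    (((Algebra.TensorProduct.cancelBaseChange K F F Lq k').toRingEquiv.trans (Algebra.TensorProduct.comm K Lq k').toRingEquiv).trans
      (Algebra.TensorProduct.congr (AlgEquiv.refl : k' ≃ₐ[K] k') e).toRingEquiv)

end LemA

/-! ## §3 (FF-sep): the residue field of the generic formal fibre is relatively `p`-radically closed -/
section Main

variable {S : Type} [CommRing S] [IsLocalRing S]

/-- **(FF-sep) The residue field of the GENERIC formal fibre over a prime is relatively `p`-radically closed.**  `S` a local G-ring,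
`Ŝ` its `𝔪`-adic completion, `P` a prime of `S` whose extension `𝔠 = P Ŝ` is prime.  Then along `S_P → Ŝ_𝔠`
(`Localization.AtPrime.algebraOfLiesOver`) every `z ∈ κ(𝔠)` with `z^p ∈ κ(P)` lies in `κ(P)` (`p` the exponential characteristic).
PROOF: the formal fibre `κ(P) ⊗_S Ŝ` is geometrically regular over `κ(P)` (`IsGRing.isRegularHom_adicCompletion_ideal`); its local ring at
the prime `q ↔ 𝔠` is `Ŝ_𝔠 ⧸ P Ŝ_𝔠 = κ(𝔠)` (Mathlib `Ideal.Fiber.localizationAlgEquivQuotient`, `𝔠 = P Ŝ`); so for `c ∈ κ(P) ∖ κ(P)^p` the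
ring `κ(P)(c^{1/p}) ⊗_{κ(P)} κ(𝔠)` is regular (§2), hence reduced (`IsRegularRing.isReduced'`) — impossible if `c = z^p` in `κ(𝔠)` (§1).
This is the hypothesis `hcl` of `RatContact.levelBound_tie_of_dominance` (…Iota3SigmaLevelLimitTie), verbatim.
[OURS · L1 W4.3 · (EX-4) (L5) input (FF-sep)] [cite: Matsumura1987, §32 p. 256 (formal fibres of a G-ring are geometrically regular)] -/
theorem pRadicallyClosed_residueField_adicCompletion (hG : IsGRing S) (P : Ideal S) [P.IsPrime]
    (𝔠 : Ideal (AdicCompletion (maximalIdeal S) S)) [𝔠.IsPrime] [𝔠.LiesOver P]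
    (h𝔠 : 𝔠 = P.map (algebraMap S (AdicCompletion (maximalIdeal S) S)))
    (p : ℕ) [ExpChar (ResidueField (Localization.AtPrime 𝔠)) p] :
    letI := Localization.AtPrime.algebraOfLiesOver P 𝔠
    ∀ z : ResidueField (Localization.AtPrime 𝔠),
      z ^ p ∈ (ResidueField.map (algebraMap (Localization.AtPrime P) (Localization.AtPrime 𝔠))).range →
      z ∈ (ResidueField.map (algebraMap (Localization.AtPrime P) (Localization.AtPrime 𝔠))).range := by
  intro z hz
  obtain ⟨c, hc⟩ := hz
  -- notation
  haveI : IsNoetherianRing S := hG.1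
  haveI : IsNoetherianRing (AdicCompletion (maximalIdeal S) S) := isNoetherianRing_adicCompletion_maximalIdeal S
  rcases ‹ExpChar (ResidueField (Localization.AtPrime 𝔠)) p› with _ | ⟨hprime⟩
  · exact ⟨c, by simpa using hc⟩
  haveI hpf : Fact p.Prime := ⟨hprime⟩
  by_cases hcp : ∃ w : ResidueField (Localization.AtPrime P), w ^ p = c
  · obtain ⟨w, hw⟩ := hcp
    refine ⟨w, frobenius_inj (ResidueField (Localization.AtPrime 𝔠)) p ?_⟩
    rw [frobenius_def, frobenius_def, ← map_pow, hw, hc]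
  push Not at hcp
  exfalso
  -- the fibre prime `q` over `P` corresponding to `𝔠`
  obtain ⟨q, hq⟩ : ∃ q : PrimeSpectrum (P.Fiber (AdicCompletion (maximalIdeal S) S)),
      q.asIdeal.comap (Algebra.TensorProduct.includeRight (R := S) (A := P.ResidueField)
        (B := AdicCompletion (maximalIdeal S) S)) = 𝔠 := by
    refine ⟨PrimeSpectrum.primesOverOrderIsoFiber S (AdicCompletion (maximalIdeal S) S) P ⟨𝔠, ‹_›, ‹_›⟩, ?_⟩
    have h := (PrimeSpectrum.primesOverOrderIsoFiber S (AdicCompletion (maximalIdeal S) S) P).symm_apply_apply ⟨𝔠, ‹_›, ‹_›⟩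
    exact congrArg Subtype.val h
  subst hq
  letI := Localization.AtPrime.algebraOfLiesOver P
    (q.asIdeal.comap (Algebra.TensorProduct.includeRight (R := S) (A := P.ResidueField) (B := AdicCompletion (maximalIdeal S) S)))
  -- Mathlib: the local ring of the fibre at `q` is `Ŝ_𝔠 ⧸ P Ŝ_𝔠`; and `P Ŝ_𝔠 = 𝔪_{Ŝ_𝔠}` because `𝔠 = P Ŝ`
  have E₁ := Ideal.Fiber.localizationAlgEquivQuotient (p := P) (S := AdicCompletion (maximalIdeal S) S) q.asIdeal
  haveI : IsLocalHom (algebraMap (Localization.AtPrime P) (Localization.AtPrime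
      (q.asIdeal.comap (Algebra.TensorProduct.includeRight (R := S) (A := P.ResidueField) (B := AdicCompletion (maximalIdeal S) S))))) := by
    rw [Localization.AtPrime.IsLiesOverAlgebra.algebraMap_eq (p := P)
      (P := q.asIdeal.comap (Algebra.TensorProduct.includeRight (R := S) (A := P.ResidueField) (B := AdicCompletion (maximalIdeal S) S)))]
    infer_instance
  have h𝔪' : P.map (algebraMap S (Localization.AtPrime
      (q.asIdeal.comap (Algebra.TensorProduct.includeRight (R := S) (A := P.ResidueField) (B := AdicCompletion (maximalIdeal S) S))))) =
      maximalIdeal _ := by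
    rw [IsScalarTower.algebraMap_eq S (AdicCompletion (maximalIdeal S) S), ← Ideal.map_map, ← h𝔠,
      Localization.AtPrime.map_eq_maximalIdeal]
  have E₂ : Localization.AtPrime q.asIdeal ≃ₐ[Localization.AtPrime P] ResidueField (Localization.AtPrime
      (q.asIdeal.comap (Algebra.TensorProduct.includeRight (R := S) (A := P.ResidueField) (B := AdicCompletion (maximalIdeal S) S)))) :=
    E₁.trans (Ideal.quotientEquivAlgOfEq (Localization.AtPrime P) h𝔪')
  -- as an equivalence of algebras over the residue field `K` of `S_P`
  have hcomm : ∀ k : ResidueField (Localization.AtPrime P), E₂ (algebraMap _ (Localization.AtPrime q.asIdeal) k) = algebraMap _ _ k := by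
    intro k
    obtain ⟨o, rfl⟩ := IsLocalRing.residue_surjective k
    rw [← ResidueField.algebraMap_eq, ← IsScalarTower.algebraMap_apply, ← IsScalarTower.algebraMap_apply, AlgEquiv.commutes]
  let E₃ : Localization.AtPrime q.asIdeal ≃ₐ[ResidueField (Localization.AtPrime P)] ResidueField (Localization.AtPrime
      (q.asIdeal.comap (Algebra.TensorProduct.includeRight (R := S) (A := P.ResidueField) (B := AdicCompletion (maximalIdeal S) S)))) :=
    AlgEquiv.ofRingEquiv (f := E₂.toRingEquiv) hcomm
  -- geometric regularity of the formal fibre over `P`, base-changed to `k' = K(c^{1/p})`, localised at `q`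
  haveI : CharP (ResidueField (Localization.AtPrime P)) p := (algebraMap (ResidueField (Localization.AtPrime P)) _).charP
    (algebraMap (ResidueField (Localization.AtPrime P)) (ResidueField (Localization.AtPrime
      (q.asIdeal.comap (Algebra.TensorProduct.includeRight (R := S) (A := P.ResidueField) (B := AdicCompletion (maximalIdeal S) S)))))).injective p
  haveI hirr : Fact (Irreducible (X ^ p - C c)) := ⟨X_pow_sub_C_irreducible_of_prime hprime hcp⟩
  have hmonic : (X ^ p - C c).Monic := monic_X_pow_sub_C c hprime.ne_zero
  haveI : Module.Finite (ResidueField (Localization.AtPrime P)) (AdjoinRoot (X ^ p - C c)) := (AdjoinRoot.powerBasis' hmonic).finite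
  have hreg : IsRegularHom S (AdicCompletion (maximalIdeal S) S) := hG.isRegularHom_adicCompletion_ideal (maximalIdeal S)
  have hF : IsRegularRing (AdjoinRoot (X ^ p - C c) ⊗[ResidueField (Localization.AtPrime P)] P.Fiber (AdicCompletion (maximalIdeal S) S)) :=
    hreg.2 P _ inferInstance
  haveI hL := isRegularRing_tensor_of_isLocalization q.asIdeal.primeCompl (Localization.AtPrime q.asIdeal) _ E₃ _ hF
  -- `z^p = c` read through `K → L`
  have hz' : z ^ p = algebraMap (ResidueField (Localization.AtPrime P)) _ c := by
    rw [← hc]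
    obtain ⟨o, rfl⟩ := IsLocalRing.residue_surjective c
    rw [ResidueField.map_residue]; rfl
  exact not_isReduced_adjoinRoot_tensor p c hcp z hz' (IsRegularRing.isReduced' _)

end Main


end FormalFibre

end Summit.ResolutionOfSingularities.ResolutionOfSingularities.Cruxes.HypersurfaceCentreConstruction.LocalEngine

end
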